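import Mathlib
import Summits.MatrixMultiplication.MatrixMultiplication.Theorems.GradedDesignFamily.Negative.SubfieldCellLiterature

/-!
# (T) from Tao's popular-set proposition: the product-set theorem via Mathlib's small-tripling API
# (crux `LevelGradedCohnUmans.GradedDesignFamily`, stmt-MatrixMultiplication-7610; negative side,
# line `quadratic-extension-level-one-cell`, unit b2b-lgcu-subfield gen 18)

HONEST FRAMING.  Hypothesis (T) of `not_subfieldCell_of_literature` (Tao 2008, Thm 4.6: sets with
`|A·B| ≤ K₀ √(|A||B|)` are controlled by an approximate group) is reduced here to the single
counting proposition behind it — Tao's Proposition 4.5 (arXiv:math/0601431, Prop. 21), case `n = 3`: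
(P21) if `|A·A⁻¹| ≤ K|A|` then some symmetric `S ∋ 1` with `|A| ≤ 2K|S|` has `|A·S³·A⁻¹| ≤ 8K⁷|A|`.
Everything else in Tao's proof of Thm 4.6 is Mathlib: the non-commutative Ruzsa triangle
inequalities, Ruzsa covering, and `IsApproximateSubgroup.of_small_tripling`.  Consequently
`¬S3 ⇐ (P21) ∧ (BGT) ∧ (Dickson)` (`not_subfieldCell_of_popularSet`).  NOT summit progress.

Sorry-free. [folklore]
-/

set_option linter.dupNamespace false

open scoped Pointwise

namespace Summit.MatrixMultiplication.MatrixMultiplication.Theorems.GradedDesignFamily.Negative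

/-- **Tao's product-set theorem (T) from the popular-set proposition (P21, n = 3).**
[Tao2006, Thm 4.6 ⇐ Prop 4.5] -/
theorem taoProductSet_of_popularSet
    (hP : ∀ (G : Type) [Group G] [DecidableEq G] (A : Finset G) (K : ℝ), A.Nonempty →
      ((A * A⁻¹).card : ℝ) ≤ K * A.card →
      ∃ S : Finset G, 1 ∈ S ∧ S⁻¹ = S ∧ (A.card : ℝ) ≤ 2 * K * S.card ∧
        ((A * S ^ 3 * A⁻¹).card : ℝ) ≤ 8 * K ^ 7 * A.card) :
    ∃ M : ℝ → ℝ, ∀ K₀ : ℝ, 1 ≤ K₀ → 1 ≤ M K₀ ∧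
      ∀ (G : Type) [Group G] [DecidableEq G] (A B : Finset G), A.Nonempty → B.Nonempty →
        ((A * B).card : ℝ) ≤ K₀ * Real.sqrt ((A.card : ℝ) * B.card) →
        ∃ H X : Finset G, IsApproximateSubgroup (M K₀) (H : Set G) ∧ (X.card : ℝ) ≤ M K₀ ∧
          (H.card : ℝ) ≤ M K₀ * Real.sqrt ((A.card : ℝ) * B.card) ∧ A ⊆ X * H ∧ B ⊆ H * X := by
  refine ⟨fun K₀ => 4096 * K₀ ^ 48, fun K₀ hK₀ => ⟨?_, ?_⟩⟩
  · have h48 : (1 : ℝ) ≤ K₀ ^ 48 := one_le_pow₀ hK₀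
    linarith
  intro G _ _ A B hA hB hAB
  have hK0 : (0 : ℝ) ≤ K₀ := by linarith
  have ha : (1 : ℝ) ≤ A.card := by exact_mod_cast hA.card_pos
  have hb : (1 : ℝ) ≤ B.card := by exact_mod_cast hB.card_pos
  have hs0 : 0 ≤ Real.sqrt ((A.card : ℝ) * B.card) := Real.sqrt_nonneg _
  have hs2 : Real.sqrt ((A.card : ℝ) * B.card) ^ 2 = (A.card : ℝ) * B.card :=
    Real.sq_sqrt (by positivity)
  have hspos : 0 < Real.sqrt ((A.card : ℝ) * B.card) := Real.sqrt_pos.2 (by positivity)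
  have hBle : (B.card : ℝ) ≤ (A * B).card := by exact_mod_cast Finset.card_le_card_mul_left hA
  have hAle : (A.card : ℝ) ≤ (A * B).card := by exact_mod_cast Finset.card_le_card_mul_right hB
  have hbs : (B.card : ℝ) ≤ K₀ * Real.sqrt ((A.card : ℝ) * B.card) := hBle.trans hAB
  have has : (A.card : ℝ) ≤ K₀ * Real.sqrt ((A.card : ℝ) * B.card) := hAle.trans hAB
  -- `√(|A||B|) ≤ K₀ |A|`
  have hsA : Real.sqrt ((A.card : ℝ) * B.card) ≤ K₀ * A.card := by
    have h1 : Real.sqrt ((A.card : ℝ) * B.card) * Real.sqrt ((A.card : ℝ) * B.card) ≤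
        K₀ * A.card * Real.sqrt ((A.card : ℝ) * B.card) := by
      have h0 : (0 : ℝ) ≤ A.card := by linarith
      calc Real.sqrt ((A.card : ℝ) * B.card) * Real.sqrt ((A.card : ℝ) * B.card)
          = (A.card : ℝ) * B.card := by rw [← sq, hs2]
        _ ≤ (A.card : ℝ) * (K₀ * Real.sqrt ((A.card : ℝ) * B.card)) :=
            mul_le_mul_of_nonneg_left hbs h0
        _ = K₀ * A.card * Real.sqrt ((A.card : ℝ) * B.card) := by ring
    exact le_of_mul_le_mul_right h1 hspos
  -- Step a: `|A A⁻¹| ≤ K₀² |A|` (Ruzsa triangle inequality)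
  have hAA : ((A * A⁻¹).card : ℝ) ≤ K₀ ^ 2 * A.card := by
    have t := Finset.ruzsa_triangle_inequality_mulInv_mul_mul A B A
    have t' : ((A * A⁻¹).card : ℝ) * B.card ≤ (A * B).card * (A * B).card := by exact_mod_cast t
    have hAB2 : ((A * B).card : ℝ) * (A * B).card ≤ K₀ ^ 2 * A.card * B.card := by
      have h0 : (0 : ℝ) ≤ (A * B).card := Nat.cast_nonneg _
      calc ((A * B).card : ℝ) * (A * B).card
          ≤ (K₀ * Real.sqrt ((A.card : ℝ) * B.card)) * (K₀ * Real.sqrt ((A.card : ℝ) * B.card)) :=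
            mul_le_mul hAB hAB h0 (mul_nonneg hK0 hs0)
        _ = K₀ ^ 2 * Real.sqrt ((A.card : ℝ) * B.card) ^ 2 := by ring
        _ = K₀ ^ 2 * A.card * B.card := by rw [hs2, mul_assoc]
    have hbpos : (0 : ℝ) < B.card := by linarith
    exact le_of_mul_le_mul_right (t'.trans hAB2) hbpos
  -- Step b: the popular set
  obtain ⟨S, h1S, hSsymm, hAS, hAS3⟩ := hP G A (K₀ ^ 2) hA hAA
  obtain ⟨a₀, ha₀⟩ := hA
  have hSpos : (0 : ℝ) < S.card := by exact_mod_cast Finset.card_pos.2 ⟨1, h1S⟩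
  have hS13 : S ⊆ S ^ 3 := by
    have h := Finset.pow_subset_pow_right (s := S) h1S (show 1 ≤ 3 by norm_num)
    rwa [pow_one] at h
  have hS23 : S ^ 2 ⊆ S ^ 3 := Finset.pow_subset_pow_right h1S (by norm_num)
  -- `|S³| ≤ |A S³ A⁻¹|`, `|A S| ≤ |A S³ A⁻¹|`
  have hS3 : ((S ^ 3).card : ℝ) ≤ (A * S ^ 3 * A⁻¹).card := by
    have hsub : {a₀} * S ^ 3 * {a₀⁻¹} ⊆ A * S ^ 3 * A⁻¹ :=
      Finset.mul_subset_mul (Finset.mul_subset_mul (Finset.singleton_subset_iff.2 ha₀) subset_rfl)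
        (Finset.singleton_subset_iff.2 (Finset.inv_mem_inv ha₀))
    have h := Finset.card_le_card hsub
    rw [Finset.card_mul_singleton, Finset.card_singleton_mul] at h
    exact_mod_cast h
  have hAS1 : ((A * S).card : ℝ) ≤ (A * S ^ 3 * A⁻¹).card := by
    have hsub : A * S * {a₀⁻¹} ⊆ A * S ^ 3 * A⁻¹ :=
      Finset.mul_subset_mul (Finset.mul_subset_mul subset_rfl hS13)
        (Finset.singleton_subset_iff.2 (Finset.inv_mem_inv ha₀))
    have h := Finset.card_le_card hsub
    rw [Finset.card_mul_singleton] at h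
    exact_mod_cast h
  -- the common numerical bound `8 (K₀²)⁷ |A| ≤ 16 K₀¹⁶ |S|`
  have hbound : 8 * (K₀ ^ 2) ^ 7 * (A.card : ℝ) ≤ 16 * K₀ ^ 16 * S.card := by
    have h0 : (0 : ℝ) ≤ 8 * (K₀ ^ 2) ^ 7 := by positivity
    calc 8 * (K₀ ^ 2) ^ 7 * (A.card : ℝ) ≤ 8 * (K₀ ^ 2) ^ 7 * (2 * K₀ ^ 2 * S.card) :=
          mul_le_mul_of_nonneg_left hAS h0
      _ = 16 * K₀ ^ 16 * S.card := by ring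
  have hS3K : ((S ^ 3).card : ℝ) ≤ 16 * K₀ ^ 16 * S.card := hS3.trans (hAS3.trans hbound)
  have hASK : ((A * S).card : ℝ) ≤ 16 * K₀ ^ 16 * S.card := hAS1.trans (hAS3.trans hbound)
  -- `H := S²` is an approximate group (Mathlib: small tripling)
  have hH : IsApproximateSubgroup ((16 * K₀ ^ 16) ^ 3) (((S ^ 2 : Finset G)) : Set G) := by
    have h := IsApproximateSubgroup.of_small_tripling (K := 16 * K₀ ^ 16) h1S hSsymm
      (by exact_mod_cast hS3K)
    simpa only [Finset.coe_pow] using h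
  -- covering `A` by left-translates of `S / S = S²`
  obtain ⟨F, -, hFcard, hAF⟩ := Finset.ruzsa_covering_mul (A := A) (B := S) ⟨1, h1S⟩ hASK
  -- covering `B⁻¹`
  have hSB : ((B⁻¹ * S).card : ℝ) ≤ 16 * K₀ ^ 18 * S.card := by
    have t := Finset.ruzsa_triangle_inequality_invMul_mul_mul S A B
    have t' : (A.card : ℝ) * (S⁻¹ * B).card ≤ (A * S).card * (A * B).card := by exact_mod_cast t
    have hcardeq : (B⁻¹ * S).card = (S⁻¹ * B).card := by
      rw [← Finset.card_inv (B⁻¹ * S), mul_inv_rev, inv_inv]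
    rw [hcardeq]
    have hapos : (0 : ℝ) < A.card := by linarith
    have h1 : (A.card : ℝ) * (S⁻¹ * B).card ≤ (A.card : ℝ) * (16 * K₀ ^ 18 * S.card) := by
      have hAS8 : ((A * S).card : ℝ) ≤ 8 * (K₀ ^ 2) ^ 7 * A.card := hAS1.trans hAS3
      have h0 : (0 : ℝ) ≤ (A * B).card := Nat.cast_nonneg _
      have h0' : (0 : ℝ) ≤ 8 * (K₀ ^ 2) ^ 7 * A.card := by positivity
      calc (A.card : ℝ) * (S⁻¹ * B).card ≤ (A * S).card * (A * B).card := t'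
        _ ≤ (8 * (K₀ ^ 2) ^ 7 * A.card) * (K₀ * Real.sqrt ((A.card : ℝ) * B.card)) :=
            mul_le_mul hAS8 hAB h0 h0'
        _ ≤ (8 * (K₀ ^ 2) ^ 7 * A.card) * (K₀ * (K₀ * A.card)) := by
            apply mul_le_mul_of_nonneg_left _ h0'
            exact mul_le_mul_of_nonneg_left hsA hK0
        _ = (A.card : ℝ) * (8 * K₀ ^ 16 * A.card) := by ring
        _ ≤ (A.card : ℝ) * (8 * K₀ ^ 16 * (2 * K₀ ^ 2 * S.card)) := by
            apply mul_le_mul_of_nonneg_left _ (by linarith)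
            exact mul_le_mul_of_nonneg_left hAS (by positivity)
        _ = (A.card : ℝ) * (16 * K₀ ^ 18 * S.card) := by ring
    exact le_of_mul_le_mul_left h1 hapos
  obtain ⟨W, -, hWcard, hBW⟩ := Finset.ruzsa_covering_mul (A := B⁻¹) (B := S) ⟨1, h1S⟩ hSB
  have hSS : S / S = S ^ 2 := by rw [div_eq_mul_inv, hSsymm, sq]
  -- assemble
  have h16 : K₀ ^ 16 ≤ K₀ ^ 48 := pow_le_pow_right₀ hK₀ (by norm_num)
  have h18 : K₀ ^ 18 ≤ K₀ ^ 48 := pow_le_pow_right₀ hK₀ (by norm_num)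
  have h15 : K₀ ^ 15 ≤ K₀ ^ 48 := pow_le_pow_right₀ hK₀ (by norm_num)
  refine ⟨S ^ 2, F ∪ W⁻¹, hH.mono (le_of_eq (by ring)), ?_, ?_, ?_, ?_⟩
  · have hu : ((F ∪ W⁻¹).card : ℝ) ≤ F.card + W.card := by
      have h := Finset.card_union_le F W⁻¹
      rw [Finset.card_inv] at h
      exact_mod_cast h
    have h1 : (0 : ℝ) ≤ K₀ ^ 48 := by positivity
    nlinarith
  · have h2 : (((S ^ 2).card : ℕ) : ℝ) ≤ (S ^ 3).card := by exact_mod_cast Finset.card_le_card hS23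
    have h3 : ((S ^ 3).card : ℝ) ≤ 8 * (K₀ ^ 2) ^ 7 * A.card := hS3.trans hAS3
    have h4 : 8 * (K₀ ^ 2) ^ 7 * (A.card : ℝ) ≤ 8 * K₀ ^ 15 * Real.sqrt ((A.card : ℝ) * B.card) := by
      have h0 : (0 : ℝ) ≤ 8 * (K₀ ^ 2) ^ 7 := by positivity
      calc 8 * (K₀ ^ 2) ^ 7 * (A.card : ℝ)
          ≤ 8 * (K₀ ^ 2) ^ 7 * (K₀ * Real.sqrt ((A.card : ℝ) * B.card)) :=
            mul_le_mul_of_nonneg_left has h0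
        _ = 8 * K₀ ^ 15 * Real.sqrt ((A.card : ℝ) * B.card) := by ring
    have h5 : 8 * K₀ ^ 15 * Real.sqrt ((A.card : ℝ) * B.card) ≤
        4096 * K₀ ^ 48 * Real.sqrt ((A.card : ℝ) * B.card) := by
      apply mul_le_mul_of_nonneg_right _ hs0
      nlinarith
    linarith
  · rw [hSS] at hAF
    exact hAF.trans (Finset.mul_subset_mul Finset.subset_union_left subset_rfl)
  · have h := Finset.inv_subset_inv hBW
    rw [inv_inv, hSS, mul_inv_rev, ← inv_pow, hSsymm] at h
    exact h.trans (Finset.mul_subset_mul subset_rfl Finset.subset_union_right)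

/-- **`¬S3` from (P21) ∧ (BGT) ∧ (Dickson).**  `not_subfieldCell_of_literature` with its hypothesis
(T) discharged down to Tao's popular-set proposition (P21).  NOT summit progress. [folklore] -/
theorem not_subfieldCell_of_popularSet
    (hP : ∀ (G : Type) [Group G] [DecidableEq G] (A : Finset G) (K : ℝ), A.Nonempty →
      ((A * A⁻¹).card : ℝ) ≤ K * A.card →
      ∃ S : Finset G, 1 ∈ S ∧ S⁻¹ = S ∧ (A.card : ℝ) ≤ 2 * K * S.card ∧
        ((A * S ^ 3 * A⁻¹).card : ℝ) ≤ 8 * K ^ 7 * A.card)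
    (hBGT : ∃ C : ℝ → ℝ, ∀ K₀ : ℝ, 1 ≤ C K₀ ∧
      ∀ (K : Type) [Field K] [Fintype K] [DecidableEq K]
        (B : Finset (Matrix.GeneralLinearGroup (Fin 2) K)),
        (∀ b ∈ B, Matrix.GeneralLinearGroup.det b = 1) →
        IsApproximateSubgroup K₀ (B : Set (Matrix.GeneralLinearGroup (Fin 2) K)) →
        Subgroup.closure (B : Set (Matrix.GeneralLinearGroup (Fin 2) K)) =
          (Matrix.GeneralLinearGroup.det : Matrix.GeneralLinearGroup (Fin 2) K →* Kˣ).ker →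
        (B.card : ℝ) ≤ C K₀ ∨
          (Nat.card (Matrix.GeneralLinearGroup.det :
              Matrix.GeneralLinearGroup (Fin 2) K →* Kˣ).ker : ℝ) ≤ C K₀ * B.card)
    (hDickson : ∀ β : ℝ, 0 < β → ∃ Q₅ : ℕ, ∀ (K : Type) [Field K] [Fintype K] [DecidableEq K],
      Q₅ ≤ Fintype.card K → ∀ L : Subgroup (Matrix.GeneralLinearGroup (Fin 2) K),
        L ≤ (Matrix.GeneralLinearGroup.det : Matrix.GeneralLinearGroup (Fin 2) K →* Kˣ).ker →
        L ≠ (Matrix.GeneralLinearGroup.det : Matrix.GeneralLinearGroup (Fin 2) K →* Kˣ).ker →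
        (∃ B : Finset (Matrix.GeneralLinearGroup (Fin 2) K),
          (↑B : Set (Matrix.GeneralLinearGroup (Fin 2) K)) ⊆ L ∧
            β * (Fintype.card K : ℝ) ^ 2 ≤ B.card) →
        ∃ v : Fin 2 → K, v ≠ 0 ∧ ∀ g ∈ L, ∃ t : K,
          (g : Matrix (Fin 2) (Fin 2) K).mulVec v = t • v) :
    ¬ (∃ c : ℝ, 0 < c ∧ ∀ N : ℕ, ∃ (k K : Type) (_ : Field k) (_ : Fintype k) (_ : DecidableEq k)
      (_ : Field K) (_ : Fintype K) (_ : DecidableEq K)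
      (φ : Matrix.SpecialLinearGroup (Fin 2) k →* Matrix.GeneralLinearGroup (Fin 2) K),
      Function.Injective φ ∧ Fintype.card K = Fintype.card k ^ 2 ∧ N ≤ Fintype.card K ∧
      ∃ Y Z : Finset (Matrix.GeneralLinearGroup (Fin 2) K),
        c * (Fintype.card K : ℝ) ^ (3 / 2 : ℝ) ≤ (Finset.univ.image φ).card ∧
        c * (Fintype.card K : ℝ) ^ (3 / 2 : ℝ) ≤ Y.card ∧
        c * (Fintype.card K : ℝ) ^ (3 / 2 : ℝ) ≤ Z.card ∧
        ∀ z₀ ∈ Z, ∃ cf : (Fin 2 → K) → (Fin 2 → K) → ℂ,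
          ∀ a : Matrix.SpecialLinearGroup (Fin 2) k, ∀ y ∈ Y, ∀ y' ∈ Y, ∀ z ∈ Z,
            (∑ u : Fin 2 → K, cf u (((φ a * y * y'⁻¹ * z : Matrix.GeneralLinearGroup (Fin 2) K) :
                Matrix (Fin 2) (Fin 2) K).mulVec u)) =
              if a = 1 ∧ y = y' ∧ z = z₀ then 1 else 0) :=
  not_subfieldCell_of_literature (taoProductSet_of_popularSet hP) hBGT hDickson

end Summit.MatrixMultiplication.MatrixMultiplication.Theorems.GradedDesignFamily.Negative
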